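import Literature.Probability.LatticeModels.IsingLaceCoefficients
import Literature.Probability.LatticeModels.WeightedCurrentsIdentities
import HarnessLib

/-!
# Sakai's "through" identity (Proposition 2.2 of Sakai 2007) for the Ising model

Topic `Probability/LatticeModels`, grouping namespace `IsingLace` (continuation of
`IsingLaceCoefficients.lean`, same setting: ferromagnetic Ising model with uniform coupling `β` on
a finite simple graph `G`, Sakai's `Λ` with bond set `𝔹_Λ = E(G)`; the removed vertex set `𝒜`
parametrises the sub-volume `𝒜ᶜ` with bond set `𝔹_{𝒜ᶜ} = offGraph G 𝒜`).

PROVED here, for EVERY real `β` (the identity "holds independently of the properties of the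
spin-spin coupling", Sakai 2007, §1.2):

* the dictionary between the restricted objects of §2.1 and the tree's random currents:
  `Σ_{∂m = B, m ⊆ 𝔹_{𝒜ᶜ}} w(m)` (supported currents of `𝔹_Λ`, (2.4)) is the current sum of the
  graph `offGraph G 𝒜` (`currentSum_offGraph`, `zOff_eq_currentSum_offGraph`), `Z_{𝒜ᶜ} > 0`
  (`zOff_pos`), and **(2.5)**: `⟨φ_xφ_y⟩_{𝒜ᶜ} = Σ_{∂m = x△y, m ⊆ 𝔹_{𝒜ᶜ}} w(m) / Z_{𝒜ᶜ}` for
  `x, y ∉ 𝒜` (`twoPointOff_eq_div`; the free state of the volume `𝒜ᶜ` is the free state on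
  `univ` of the graph `offGraph G 𝒜`, `isingTwoPoint_compl_eq_offGraph_univ`);
* **Proposition 2.2** ((2.19)): for all `v, x` and `𝒜`,
  `⟨φ_vφ_x⟩_Λ - ⟨φ_vφ_x⟩_{𝒜ᶜ} = Σ_{∂m = ∅ (m ⊆ 𝔹_{𝒜ᶜ}), ∂n = v△x} (w_{𝒜ᶜ}(m)/Z_{𝒜ᶜ}) (w_Λ(n)/Z_Λ) 1{v ⟷_{m+n} x through 𝒜}`
  (`twoPoint_sub_twoPointOff_eq_tsum`), by the printed route: random-current representation of
  both terms ((2.20)), the source-switching lemma (Lemma 2.3 = the tree's nested switching lemma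
  `Current.tsum_switching` with first current supported on `offGraph G 𝒜`) for the second
  ((2.21)–(2.23)), and `{through 𝒜} = {connected} ∖ {connected in 𝒜ᶜ}` ((2.7), (2.24));
* its corollary "Therefore `⟨φ_vφ_x⟩_{𝒜ᶜ} ≤ ⟨φ_vφ_x⟩_Λ` for the ferromagnetic case"
  (`twoPointOff_le_twoPoint`, `β ≥ 0`).

This is the first input of the second stage of the lace expansion (§2.2.2) towards the tree's
named fact `IsingLace.Sakai2007_prop11`.

## References

* A. Sakai, *Lace expansion for the Ising model*, Comm. Math. Phys. 272 (2007) 283–344,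
  arXiv:math-ph/0510093: §2.1 ((2.3)–(2.6)), §2.2.2 (Proposition 2.2 with (2.19), Lemma 2.3,
  (2.20)–(2.24)) [Sakai2007].
(Equation numbers are those of the arXiv version held in the literature store, every display
counted.)
-/

noncomputable section

open Finset
open scoped symmDiff BigOperators

namespace Literature.Probability.LatticeModels

variable {V : Type*} [Fintype V] [DecidableEq V] (G : SimpleGraph V) [DecidableRel G.Adj]

namespace IsingLace

/-! ## Restricted current sums with prescribed sources ((2.4)) -/

variable {G}

/-- The restricted weights `1{m ⊆ 𝔹_{𝒜ᶜ}, ∂m = B} w_β(m)` are absolutely summable (dominated by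
`w_{|β|}`). [folklore] -/
theorem summable_weight_isSupp_offGraph (β : ℝ) (A B : Finset V) :
    Summable fun n : Current G =>
      if Current.IsSupp (offGraph G A) n ∧ n.sources = B then n.weight β else 0 :=
  (Current.summable_weight_abs G β).of_norm_bounded fun n => by
    split_ifs
    · rw [Real.norm_eq_abs, Current.abs_weight]
    · rw [norm_zero]; exact Current.weight_nonneg (abs_nonneg β) n

/-- **(2.4): currents of the sub-bond-set `𝔹_{𝒜ᶜ}` are the currents of `𝔹_Λ` supported on it** —
the current sum of the graph `offGraph G 𝒜` with sources `B` is
`Σ_{∂m = B, m|_{𝔹_Λ ∖ 𝔹_{𝒜ᶜ}} ≡ 0} w_Λ(m)` (extension by zero, `Current.extend`).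
[cite: Sakai2007, (2.4)] -/
theorem currentSum_offGraph (β : ℝ) (A B : Finset V) :
    currentSum (offGraph G A) β B =
      ∑' n : Current G, if Current.IsSupp (offGraph G A) n ∧ n.sources = B then n.weight β else 0 := by
  unfold currentSum
  have h := Current.tsum_extend_eq (G := G) (G₁ := offGraph G A) (offGraph_le A)
    (fun n : Current G => if n.sources = B then n.weight β else 0)
  simp only [Current.sources_extend (offGraph_le A), Current.weight_extend (offGraph_le A)] at h
  rw [h]
  refine tsum_congr fun n => ?_
  by_cases hs : Current.IsSupp (offGraph G A) n
  · by_cases hB : n.sources = B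
    · rw [if_pos hs, if_pos hB, if_pos ⟨hs, hB⟩]
    · rw [if_pos hs, if_neg hB, if_neg fun h => hB h.2]
  · rw [if_neg hs, if_neg fun h => hs h.1]

/-- **(2.3)–(2.4)**: `Z_{𝒜ᶜ}` (`zOff`) is the sourceless current sum of the graph `offGraph G 𝒜`.
[cite: Sakai2007, (2.3)–(2.4)] -/
theorem zOff_eq_currentSum_offGraph (β : ℝ) (A : Finset V) :
    zOff G β A = currentSum (offGraph G A) β ∅ := by
  rw [currentSum_offGraph]
  rfl

/-- `Z_{𝒜ᶜ} > 0` for every real `β` (it is `2^{-|V|}` times a partition function). [cite: Sakai2007, (2.3)] -/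
theorem zOff_pos (β : ℝ) (A : Finset V) : 0 < zOff G β A := by
  rw [zOff_eq_currentSum_offGraph]
  exact currentSum_empty_pos' (offGraph G A) β

/-! ## The restricted two-point function in random currents ((2.5)) -/

/-- The edges of `G` inside `𝒜ᶜ` are the edges of `offGraph G 𝒜` inside `𝒜ᶜ`. [folklore] -/
theorem edgesIn_compl_eq (A : Finset V) : edgesIn G Aᶜ = edgesIn (offGraph G A) Aᶜ := by
  ext e
  rw [mem_edgesIn_iff, mem_edgesIn_iff, mem_edgeSet_offGraph]
  constructor
  · rintro ⟨he, hA⟩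
    exact ⟨⟨he, fun v hv => Finset.mem_compl.1 (hA v hv)⟩, hA⟩
  · rintro ⟨⟨he, -⟩, hA⟩
    exact ⟨he, hA⟩

/-- Every edge of `offGraph G 𝒜` lies inside `𝒜ᶜ`. [folklore] -/
theorem edgesIn_offGraph_univ_subset (A : Finset V) :
    edgesIn (offGraph G A) univ ⊆ edgesIn (offGraph G A) Aᶜ := by
  intro e he
  rw [mem_edgesIn_iff] at he ⊢
  exact ⟨he.1, fun v hv => Finset.mem_compl.2 ((mem_edgeSet_offGraph.1 he.1).2 v hv)⟩

/-- **The free state of the volume `𝒜ᶜ` is the free state of the graph `offGraph G 𝒜`**: for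
`x, y ∉ 𝒜`, `⟨φ_xφ_y⟩_{𝒜ᶜ}` (free boundary condition in the volume `𝒜ᶜ` of `G`) equals the
two-point function on the whole vertex set for the graph with the bonds meeting `𝒜` removed
("the partition function on `Λ` with `J_b = 0` for all `b ∈ 𝔹_Λ ∖ 𝔹_𝒜`", §2.1; the spins of `𝒜`
decouple). [cite: Sakai2007, §2.1 (between (2.3) and (2.4))] -/
theorem isingTwoPoint_compl_eq_offGraph_univ (β : ℝ) {A : Finset V} {x y : V} (hx : x ∉ A)
    (hy : y ∉ A) :
    isingTwoPoint G Aᶜ β 0 .free x y = isingTwoPoint (offGraph G A) univ β 0 .free x y := by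
  by_cases hxy : x = y
  · subst hxy
    rw [isingTwoPoint_self, isingTwoPoint_self]
  have h1 : isingTwoPoint G Aᶜ β 0 .free x y = isingTwoPoint (offGraph G A) Aᶜ β 0 .free x y := by
    unfold isingTwoPoint isingExpect
    rw [isingMeasure_free_congr_edgesIn (edgesIn_compl_eq (G := G) A) β 0]
  have hsub : ({x, y} : Finset V) ⊆ Aᶜ :=
    Finset.insert_subset_iff.2 ⟨Finset.mem_compl.2 hx,
      Finset.singleton_subset_iff.2 (Finset.mem_compl.2 hy)⟩
  rw [h1, isingTwoPoint_eq_isingCorr _ _ _ _ _ hxy, isingTwoPoint_eq_isingCorr _ _ _ _ _ hxy]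
  exact (isingCorr_free_eq_of_edgesIn_subset (offGraph G A) (Finset.subset_univ Aᶜ)
    (edgesIn_offGraph_univ_subset A) β 0 hsub).symm

/-- **(2.5)**: for `x, y ∉ 𝒜`, `⟨φ_xφ_y⟩_{𝒜ᶜ} = Σ_{∂m = x△y, m ⊆ 𝔹_{𝒜ᶜ}} w(m) / Z_{𝒜ᶜ}` — the
random-current representation of the restricted two-point function by the currents of
`offGraph G 𝒜` — for every real `β`. [cite: Sakai2007, (2.5)] -/
theorem twoPointOff_eq_div (β : ℝ) {A : Finset V} {x y : V} (hx : x ∉ A) (hy : y ∉ A) :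
    twoPointOff G β A x y = currentSum (offGraph G A) β ({x} ∆ {y}) / zOff G β A := by
  unfold twoPointOff
  rw [if_pos ⟨hx, hy⟩, isingTwoPoint_compl_eq_offGraph_univ β hx hy,
    isingTwoPoint_free_eq_currentSum_div_holds (offGraph G A) β x y, zOff_eq_currentSum_offGraph]

/-- `⟨φ_xφ_y⟩_{𝒜ᶜ}` vanishes when an endpoint lies in `𝒜`. [cite: Sakai2007, §2.1 (below (2.6))] -/
theorem twoPointOff_of_not (β : ℝ) {A : Finset V} {x y : V} (h : ¬(x ∉ A ∧ y ∉ A)) :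
    twoPointOff G β A x y = 0 := if_neg h

/-- **(2.9)** (random-current representation of the full-volume two-point function):
`⟨φ_vφ_x⟩_Λ = Σ_{∂n = v△x} w(n) / Z_Λ`, with `Z_Λ = zOff G β ∅`. [cite: Sakai2007, (2.9)] -/
theorem twoPoint_eq_div (β : ℝ) (v x : V) :
    isingTwoPoint G univ β 0 .free v x = currentSum G β ({v} ∆ {x}) / zOff G β ∅ := by
  rw [zOff_empty]
  exact isingTwoPoint_free_eq_currentSum_div_holds G β v x

/-! ## Proposition 2.2 -/

/-- Summability of `a(m) b(n) Φ(m,n)` for the restricted sourceless weight `a`, the weight `b`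
with sources `v △ x`, and bounded `Φ` (domination by `w_{|β|}(m) w_{|β|}(n)`). [folklore] -/
theorem summable_offPair_mul (β : ℝ) (A : Finset V) (B : Finset V)
    {Φ : Current G × Current G → ℝ} {C : ℝ} (hΦ : ∀ p, |Φ p| ≤ C) :
    Summable fun p : Current G × Current G =>
      (if Current.IsSupp (offGraph G A) p.1 ∧ p.1.sources = ∅ then p.1.weight β else 0) *
        (if p.2.sources = B then p.2.weight β else 0) * Φ p := by
  have hw := Current.summable_weight_abs G β
  have hprod : Summable fun p : Current G × Current G =>
      Current.weight |β| p.1 * Current.weight |β| p.2 :=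
    summable_mul_of_summable_norm (f := fun n : Current G => Current.weight |β| n)
      (g := fun n : Current G => Current.weight |β| n)
      (hw.norm.congr fun n => by simp) (hw.norm.congr fun n => by simp)
  have hC : 0 ≤ C := le_trans (abs_nonneg _) (hΦ (0, 0))
  refine (hprod.mul_right C).of_norm_bounded fun p => ?_
  rw [Real.norm_eq_abs, abs_mul, abs_mul]
  have h0 := Current.weight_nonneg (abs_nonneg β) p.1
  have h0' := Current.weight_nonneg (abs_nonneg β) p.2
  refine mul_le_mul (mul_le_mul ?_ ?_ (abs_nonneg _) h0) (hΦ p) (abs_nonneg _) (mul_nonneg h0 h0')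
  · split_ifs
    · rw [Current.abs_weight]
    · rw [abs_zero]; exact h0
  · split_ifs
    · rw [Current.abs_weight]
    · rw [abs_zero]; exact h0'

/-- On `{∂n = v △ x}` the vertices `v`, `x` are `(m+n)`-connected. [cite: Sakai2007, §2.1 (last paragraph) and (2.9)] -/
theorem conn_add_of_sources_eq (m : Current G) {n : Current G} {v x : V}
    (hs : n.sources = {v} ∆ {x}) : Conn G (m + n) v x :=
  conn_iff_mem_cluster.2 (Current.mem_cluster_add_of_sources_eq_right m hs)

open Classical in
/-- **Sakai 2007, Proposition 2.2** (the "through" identity (2.19)): for every finite graph,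
every real `β`, all `v, x` and every removed set `𝒜`,
`⟨φ_vφ_x⟩_Λ - ⟨φ_vφ_x⟩_{𝒜ᶜ} = Σ_{∂m = ∅, ∂n = v△x} (w_{𝒜ᶜ}(m)/Z_{𝒜ᶜ}) (w_Λ(n)/Z_Λ) 1{v ⟷_{m+n} x through 𝒜}`,
the current `m` living on `𝔹_{𝒜ᶜ} = offGraph G 𝒜` and `n` on `𝔹_Λ`; written, as Sakai's `Θ`
((2.30), `IsingLace.theta`), as an absolutely convergent `tsum` over pairs of currents of `𝔹_Λ` with
`m` constrained to be supported on `𝔹_{𝒜ᶜ}`. Proof as printed: random-current representation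
of both terms ((2.20)), the source-switching lemma (Lemma 2.3; the tree's
`Current.tsum_switching`) for the second ((2.21)–(2.23)), and (2.7) ((2.24)).
[cite: Sakai2007, Proposition 2.2, (2.19)–(2.24)] -/
theorem twoPoint_sub_twoPointOff_eq_tsum (β : ℝ) (A : Finset V) (v x : V) :
    isingTwoPoint G univ β 0 .free v x - twoPointOff G β A v x =
      ∑' p : Current G × Current G,
        (if Current.IsSupp (offGraph G A) p.1 ∧ p.1.sources = ∅ then p.1.weight β / zOff G β A
          else 0) *
          (if p.2.sources = {v} ∆ {x} then p.2.weight β / zOff G β ∅ else 0) *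
          (if ConnThrough G (p.1 + p.2) A v x then 1 else 0) := by
  set ZA : ℝ := zOff G β A with hZA_def
  set Z : ℝ := zOff G β ∅ with hZ_def
  have hZA : 0 < ZA := zOff_pos β A
  have hZ : 0 < Z := zOff_pos β ∅
  set B : Finset V := {v} ∆ {x} with hB
  -- unnormalised weights
  set a : Current G → ℝ := fun m =>
    if Current.IsSupp (offGraph G A) m ∧ m.sources = ∅ then m.weight β else 0 with ha
  set b : Current G → ℝ := fun n => if n.sources = B then n.weight β else 0 with hb
  -- Step 1: pull out the normalisation
  have hnorm : ∀ p : Current G × Current G,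
      (if Current.IsSupp (offGraph G A) p.1 ∧ p.1.sources = ∅ then p.1.weight β / ZA else 0) *
          (if p.2.sources = B then p.2.weight β / Z else 0) *
          (if ConnThrough G (p.1 + p.2) A v x then (1 : ℝ) else 0) =
        (ZA * Z)⁻¹ * (a p.1 * b p.2 * (if ConnThrough G (p.1 + p.2) A v x then (1 : ℝ) else 0)) := by
    intro p
    simp only [ha, hb]
    split_ifs <;> ring
  rw [tsum_congr hnorm, tsum_mul_left]
  -- Step 2: `1{through} = 1 - 1{in 𝒜ᶜ}` on the support of `b`
  have hind : ∀ p : Current G × Current G,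
      a p.1 * b p.2 * (if ConnThrough G (p.1 + p.2) A v x then (1 : ℝ) else 0) =
        a p.1 * b p.2 * 1 - a p.1 * b p.2 * (if ConnAvoid G (p.1 + p.2) A v x then (1 : ℝ) else 0) := by
    intro p
    by_cases hs : p.2.sources = B
    · have hconn : Conn G (p.1 + p.2) v x := conn_add_of_sources_eq p.1 hs
      unfold ConnThrough
      by_cases hav : ConnAvoid G (p.1 + p.2) A v x
      · rw [if_neg (fun h => h.2 hav), if_pos hav]; ring
      · rw [if_pos ⟨hconn, hav⟩, if_neg hav]; ring
    · have hb0 : b p.2 = 0 := if_neg hs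
      rw [hb0]; ring
  have hs1 : Summable fun p : Current G × Current G => a p.1 * b p.2 * (1 : ℝ) :=
    summable_offPair_mul β A B (Φ := fun _ => 1) (C := 1) fun _ => by simp
  have hs2 : Summable fun p : Current G × Current G =>
      a p.1 * b p.2 * (if ConnAvoid G (p.1 + p.2) A v x then (1 : ℝ) else 0) :=
    summable_offPair_mul β A B (C := 1) fun p => by split_ifs <;> simp
  rw [tsum_congr hind, hs1.tsum_sub hs2]
  -- Step 3: `Σ a b = Z_{𝒜ᶜ} · Σ_{∂n = v△x} w(n)`
  have ha_s : Summable fun m : Current G => ‖a m‖ := (summable_weight_isSupp_offGraph β A ∅).norm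
  have hb_s : Summable fun n : Current G => ‖b n‖ := (summable_currentWeight_indicator_holds G β B).norm
  have h3 : ∑' p : Current G × Current G, a p.1 * b p.2 * (1 : ℝ) = ZA * currentSum G β B := by
    simp only [mul_one]
    rw [← tsum_mul_tsum_of_summable_norm ha_s hb_s]
    rfl
  -- Step 4: the switching lemma evaluates `Σ a b 1{v ⟷ x in 𝒜ᶜ}`
  have h4 : ∑' p : Current G × Current G,
      a p.1 * b p.2 * (if ConnAvoid G (p.1 + p.2) A v x then (1 : ℝ) else 0) =
        if v ∉ A ∧ x ∉ A then currentSum (offGraph G A) β B * Z else 0 := by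
    by_cases hvx : v ∉ A ∧ x ∉ A
    · rw [if_pos hvx]
      -- rewrite the indicator as the `connIn` indicator
      have hre : ∀ p : Current G × Current G,
          a p.1 * b p.2 * (if ConnAvoid G (p.1 + p.2) A v x then (1 : ℝ) else 0) =
            (if Current.IsSupp (offGraph G A) p.1 ∧ p.1.sources = ∅ then p.1.weight β else 0) *
              (if p.2.sources ∩ univ = B then p.2.weight β else 0) *
              ((fun _ => (1 : ℝ)) (p.1 + p.2) *
                (Current.connIn (offGraph G A) v x).indicator 1 (p.1 + p.2)) := by
        intro p
        simp only [ha, hb, Finset.inter_univ, one_mul]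
        congr 1
        unfold ConnAvoid
        rw [Set.indicator_apply]
        by_cases hc : p.1 + p.2 ∈ Current.connIn (offGraph G A) v x
        · rw [if_pos ⟨hvx.1, hvx.2, hc⟩, if_pos hc, Pi.one_apply]
        · rw [if_neg (fun h => hc h.2.2), if_neg hc]
      rw [tsum_congr hre, Current.tsum_switching (G₁ := offGraph G A) β univ ∅ B v x (fun _ => 1)
        ⟨1, fun _ => by simp⟩]
      -- evaluate the switched sum
      have hre' : ∀ p : Current G × Current G,
          (if Current.IsSupp (offGraph G A) p.1 ∧ p.1.sources = ∅ ∆ ({v} ∆ {x}) then p.1.weight β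
              else 0) *
            (if p.2.sources ∩ univ = B ∆ (({v} ∆ {x}) ∩ univ) then p.2.weight β else 0) *
            ((fun _ => (1 : ℝ)) (p.1 + p.2) *
              (Current.connIn (offGraph G A) v x).indicator 1 (p.1 + p.2)) =
          (if Current.IsSupp (offGraph G A) p.1 ∧ p.1.sources = B then p.1.weight β else 0) *
            (if p.2.sources = ∅ then p.2.weight β else 0) := by
        intro p
        have hBB : B ∆ ({v} ∆ {x}) = ∅ := by
          rw [hB, symmDiff_self, Finset.bot_eq_empty]
        have h0B : (∅ : Finset V) ∆ ({v} ∆ {x}) = B := by rw [hB]; exact bot_symmDiff _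
        simp only [Finset.inter_univ, one_mul, h0B]
        rw [hBB]
        by_cases h1 : Current.IsSupp (offGraph G A) p.1 ∧ p.1.sources = B
        · rw [if_pos h1, Set.indicator_of_mem
            (Current.add_mem_connIn_of_sources_eq (offGraph G A) h1.1 h1.2 p.2), Pi.one_apply,
            mul_one]
        · simp only [if_neg h1, zero_mul]
      rw [tsum_congr hre', hZ_def, zOff_empty, currentSum_offGraph, currentSum]
      exact (tsum_mul_tsum_of_summable_norm (summable_weight_isSupp_offGraph (G := G) β A B).norm
        (summable_currentWeight_indicator_holds G β ∅).norm).symm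
    · rw [if_neg hvx]
      refine (tsum_congr fun p => ?_).trans tsum_zero
      rw [if_neg (fun h : ConnAvoid G (p.1 + p.2) A v x => hvx ⟨h.1, h.2.1⟩), mul_zero]
  rw [h3, h4, twoPoint_eq_div, ← hZ_def, ← hB]
  -- assemble
  have hZA0 : ZA ≠ 0 := hZA.ne'
  have hZ0 : Z ≠ 0 := hZ.ne'
  by_cases hvx : v ∉ A ∧ x ∉ A
  · rw [if_pos hvx, twoPointOff_eq_div β hvx.1 hvx.2, ← hZA_def, ← hB]
    field_simp
  · rw [if_neg hvx, twoPointOff_of_not β hvx]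
    field_simp
    ring

/-- **Corollary of Proposition 2.2** ("Therefore `⟨φ_vφ_x⟩_{𝒜ᶜ} ≤ ⟨φ_vφ_x⟩_Λ` for the
ferromagnetic case"): for `β ≥ 0` every summand of (2.19) is nonnegative. [cite: Sakai2007, Proposition 2.2] -/
theorem twoPointOff_le_twoPoint {β : ℝ} (hβ : 0 ≤ β) (A : Finset V) (v x : V) :
    twoPointOff G β A v x ≤ isingTwoPoint G univ β 0 .free v x := by
  classical
  have h := twoPoint_sub_twoPointOff_eq_tsum (G := G) β A v x
  have hnn : 0 ≤ isingTwoPoint G univ β 0 .free v x - twoPointOff G β A v x := by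
    rw [h]
    refine tsum_nonneg fun p => mul_nonneg (mul_nonneg ?_ ?_) ?_
    · split_ifs
      · exact div_nonneg (Current.weight_nonneg hβ _) (zOff_pos β A).le
      · exact le_rfl
    · split_ifs
      · exact div_nonneg (Current.weight_nonneg hβ _) (zOff_pos β ∅).le
      · exact le_rfl
    · split_ifs
      · exact zero_le_one
      · exact le_rfl
  linarith

end IsingLace

end Literature.Probability.LatticeModels

end
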